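import Literature.AlgebraicGeometry.AbelianSchemes.MumfordDualOfConnectedAffineAnyChar
import Literature.AlgebraicGeometry.AbelianSchemes.CechH1CountOfPoincareDataHead
import Literature.AlgebraicGeometry.AbelianSchemes.AbelianSchemeKOfLEtaleOfInvertibleOrder
import Literature.AlgebraicGeometry.AbelianSchemes.AbelianSchemeKOfLBaseChange
import Literature.AlgebraicGeometry.AbelianSchemes.ProjectiveAbelianSchemeAmpleClass
import Literature.AlgebraicGeometry.AbelianSchemes.DualPairHatCocycle
import Literature.AlgebraicGeometry.AbelianSchemes.DualPairOfGluedHatGlue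
import Literature.AlgebraicGeometry.AbelianSchemes.DualPairOfGluedHatCompat
import Literature.AlgebraicGeometry.AbelianSchemes.GraphPointLevelZero
import Literature.AlgebraicGeometry.AbelianSchemes.MumfordQuotientConstruction
import Mathlib.AlgebraicGeometry.Noetherian
import HarnessLib

/-!
# THE DUAL ABELIAN SCHEME OF A PROJECTIVE ABELIAN SCHEME WITH A RIGIDIFIED FIBREWISE-AMPLE `L` OF INVERTIBLE `K(L)`-EXPONENT EXISTS — any characteristic
# ([MumfordAV1970] §13 Theorem p. 125 + §23; [MumfordFogartyKirwan1994] Ch. 6 §1 Cor. 6.8, §2 Prop. 6.13 (iii)) — the road-(A) closer of the hodgecm socket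
# `stub_DUALS : DualPairOfAmpleRigidified`

Layer `Literature/AlgebraicGeometry/AbelianSchemes`, namespace `Literature.AlgebraicGeometry.AbelianSchemes.MumfordDual`.  THEOREMS ONLY (no definition,
no named fact, no instance, no notation, no `sorry`).  Cell `hodgecm-mathlib` (D-0151), P6 «MOD programme», L4 DUALS road (LEAD F0P6-plan (g3) «M-55c»
2026-09-02: the P-line socket `stub_DUALS` re-typed from the hypothesis-free printed row P-2′ `dualAbelianSchemeExists` — [FaltingsChai1990] I 1.9 strength,
not payable in-house — to `DualPairOfAmpleRigidified`; LA4-p05 (g0) letter + closer).  **O3e = THE ROAD-(A) HEAD**: the statement of this file's main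
theorem IS the text of `def DualPairOfAmpleRigidified : Prop` (P-line `Cruxes/HLiu418/Lines/F0_P6a_PELInputs.lean`, letter v1.1, 9 binders
`R A hA L hL hε hΘ n hn hkill`) token for token AFTER ONE NAMED HOLE BINDER `hHead` — the (H-b) `H¹`-count head ([MumfordAV1970] §13 Cor. 2:
`dim H¹(A₀, 𝒪) = dim A₀` for an abelian scheme `A₀` over a field carrying a rank-one `L₀` whose `K(L₀)` is killed by an integer non-zero in the field; LA4-plan (g0)
ruling 2026-09-02T03:21:41Z (5), B-p04 (g42): the hypothesis-free head is not payable in positive characteristic in-house), threaded through the ★ chain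
(1) `PoincareFamilyKSSurjectiveAnyChar` → (2) `MumfordDualArtinianTowerAnyChar` → (3) `MumfordDualUniversalityAnyChar` → (4) `MumfordDualOfConnectedAffineAnyChar`
as their uniform `hH1` hypothesis — so the Lines-side closer is `theorem stub_DUALS : DualPairOfAmpleRigidified := nonempty_dualPair_of_isProjective_of_isUnit ‹head›`
the minute a theorem of `hHead`'s type lands.

THE PROOF ([MumfordAV1970] §13 run relative to a Noetherian affine base of ANY characteristic, the F-3 tower ★ `Theorems/F3DualAbelianScheme*` OFF `ℚ`):
(K′) ★ `exists_kOfL_etale_of_isUnit` makes `K(L)` a finite ÉTALE closed subgroup scheme `i` with `i ^ n = 1` (this is where `n ∈ R^×` and `hkill` enter);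
cover `Spec R` by CONNECTED affine opens (★ `Morphisms.exists_connected_affine_nbhd`); on each chart the base change is projective (★ `IsProjective.pullback_snd`),
`L|` keeps rank one ∕ rigidification ∕ ample fibre classes (★ `pullback_unitSection_detClass_baseChange_eq_one`, ★ `exists_isAmple_cechClass_fibre_baseChange`),
`K(L|)` is killed by `n` (★ `IsBaseChangeVia.pow_eq_one_of_memKOfL_pullback`) hence (K′) again finite étale on the chart, and ★ (M′)
`MumfordDual.nonempty_dualPair_of_isProjective_of_split` (Mumford's `A⁄K(L)` with its descended Poincaré bundle, universal by the any-characteristic Artinian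
tower ★ `MumfordDualArtinianTowerAnyChar` over [MumfordAV1970] §13 Cor. 2 ∕ §8 Thm. 1 in any characteristic) gives the chart's dual pair; the chart duals GLUE
(★ (Z) `exists_gluedHat` + `nonempty_pullback_chartP_iso_of_gluedHat` + `nonempty_dualPair_of_gluedHat_of_compat`: dual pairs are unique up to unique
isomorphism, [BoschLutkebohmertRaynaud1990] §8.1 Prop. 4).  The zero ring is covered by the EMPTY cover.

* (private) `nonempty_dualPair_of_openCover'` — the (Z) glue ★ `Theorems/F3DualAbelianSchemeStubZ.stub_F3Z_holds`, Literature-homed (3 lines over ★).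
* **`nonempty_dualPair_of_isProjective_of_isUnit`** — THE HEAD = `hHead → DualPairOfAmpleRigidified` unfolded (`hHead` = the (H-b) `H¹`-count hole).
* `nonempty_dualPair_of_charts_of_isProjective_of_isUnit` — the same glued over any locally Noetherian base from a family of affine charts carrying data of
  the letter's shape (the chain's step (4) on the stage base, charts by ★ O4-ε `RankOneLocalEmbeddingSpreadDedekind`).

HC_CM is proved only modulo the printed citations (2 remaining named inputs hLiu418 24832, h413 24833) until rung 0 closes; this file discharges the
re-typed socket's Prop as a Literature theorem (count-neutral until the P-line folds it) and asserts nothing about HC.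

## References
* [MumfordAV1970] D. Mumford, *Abelian Varieties* (1970), §13 Theorem (p. 125) and its proof (pp. 125–130), §13 Cor. 2, §8 Thm. 1 (p. 77), §23.
* [MumfordFogartyKirwan1994] D. Mumford, J. Fogarty, F. Kirwan, *Geometric Invariant Theory*, 3rd ed. (1994), Ch. 6 §1 Cor. 6.8 (p. 118), §2 (p. 121),
  Prop. 6.13 (iii) (p. 123).
* [BoschLutkebohmertRaynaud1990] S. Bosch, W. Lütkebohmert, M. Raynaud, *Néron Models* (1990), §8.1 Prop. 4 (pp. 204–205).
* [GortzWedhorn2023] U. Görtz, T. Wedhorn, *Algebraic Geometry II* (2023), Cor. 27.212 (pp. 685–686), Def. 27.216 (p. 689).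
* [FaltingsChai1990] G. Faltings, C.-L. Chai, *Degeneration of Abelian Varieties* (1990), Ch. I §1 Thm. 1.9 (the hypothesis-free statement, NOT proved here).
* [MilneAV2008] J. S. Milne, *Abelian Varieties* (2008), I §8 pp. 36–37.
-/

noncomputable section

open CategoryTheory CategoryTheory.Limits AlgebraicGeometry MonoidalCategory CartesianMonoidalCategory
open scoped MonObj
open Literature.AlgebraicGeometry.AbelianSchemes Literature.AlgebraicGeometry.Motives Literature.AlgebraicGeometry.AbelianVarieties
  Literature.AlgebraicGeometry.Modules
open Literature.AlgebraicGeometry.Morphisms (IsProjective exists_connected_affine_nbhd)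

namespace Literature.AlgebraicGeometry.AbelianSchemes

namespace MumfordDual

/-- **(Z) DUAL PAIRS GLUE ALONG A ZARISKI COVER OF THE BASE** (★ `stub_F3Z_holds`, Literature-homed): if `A ×_S Uᵢ` has a dual pair for every member of an open
cover of the locally Noetherian `S`, then `A` has a dual pair (★ `exists_gluedHat` ∘ `nonempty_pullback_chartP_iso_of_gluedHat` ∘ `nonempty_dualPair_of_gluedHat_of_compat`
on the re-indexed cover `𝒰.ulift`). [cite: BoschLutkebohmertRaynaud1990, §8.1 Prop. 4 (pp. 204–205)] [cite: MumfordAV1970, §13 p. 125] -/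
private theorem nonempty_dualPair_of_openCover' ⦃S : Scheme.{0}⦄ [IsLocallyNoetherian S] (A : AbelianSchemeOver S) (𝒰 : S.OpenCover)
    (D : ∀ i, (A.baseChange (𝒰.f i)).DualPair) : Nonempty A.DualPair := by
  obtain ⟨H, χ, hχ, hglue⟩ := A.exists_gluedHat 𝒰.ulift (fun x => D (𝒰.idx x))
  exact A.nonempty_dualPair_of_gluedHat_of_compat 𝒰.ulift (A.chartDual 𝒰.ulift fun x => D (𝒰.idx x)) H χ hχ
    (fun T b i j mi mj hmi hmj =>
      A.nonempty_pullback_chartP_iso_of_gluedHat 𝒰.ulift (fun x => D (𝒰.idx x)) H χ hχ hglue b i j mi mj hmi hmj)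

/-- **THE DUAL ABELIAN SCHEME EXISTS for a PROJECTIVE abelian scheme over a Noetherian ring carrying a rank-one `L` rigidified along the unit section, fibrewise of
the class of an ample divisor, whose `K(L)` is killed by an exponent `n` INVERTIBLE in the ring** — any characteristic ([MumfordAV1970] §13 Theorem: `Â = A⁄K(L)`
with the descended Poincaré bundle, universal; §23 ∕ [MumfordFogartyKirwan1994] Prop. 6.13 (iii) for the étaleness of `K(L)`).  The statement is the hodgecm
letter `DualPairOfAmpleRigidified` TOKEN FOR TOKEN (binders `R A hA L hL hε hΘ n hn hkill`, conclusion `Nonempty A.DualPair` = ★ `AbelianSchemeOver.DualPair`: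
`Â`, rank-one Poincaré bundle rigidified along `ε × 1`, fibrewise `Pic⁰`, universal) AFTER the one named hole binder `hHead` = the (H-b) head
`dim_K H¹(A₀, 𝒪) = dim A₀` (Čech, any finite affine cover) for abelian schemes `A₀` over fields with a rank-one `L₀` of `K(L₀)` killed by an integer non-zero in
the field ([MumfordAV1970] §13 Cor. 2).  Proof: (K′) ★ `exists_kOfL_etale_of_isUnit`; connected affine charts ★ `exists_connected_affine_nbhd`; per chart (K′)
again, the chart family's `hH1` read off `hHead` at the triple base change (★ `IsBaseChangeVia.trans` ∕ `pow_eq_one_of_memKOfL_pullback`), and ★ (M′)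
`nonempty_dualPair_of_isProjective_of_split`; (Z) glue.  Over the zero ring: the empty cover.
[cite: MumfordAV1970, §13 Theorem (p. 125) and §23] [cite: MumfordFogartyKirwan1994, Ch. 6 §1 Cor. 6.8 (p. 118) and §2 Prop. 6.13 (iii) (p. 123)]
[cite: GortzWedhorn2023, Cor. 27.212 (pp. 685–686)] -/
theorem nonempty_dualPair_of_isProjective_of_isUnit
    -- (H-b) THE `H¹`-COUNT HEAD AS A HYPOTHESIS ([MumfordAV1970] §13 Cor. 2 for an abelian scheme over a field whose `K(L)` is killed by an
    -- integer invertible in the field; owner B-p04 (g42), LA4-plan (g0) ruling 2026-09-02T03:21:41Z (5)): the ONE named hole of the road-(A) chain.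
    (hHead : ∀ (K₁ : Type) [Field K₁] (A₀ : AbelianSchemeOver (Spec (.of K₁))) (L₀ : A₀.left.Modules), HasRank L₀ 1 →
      ∀ n : ℕ, (n : K₁) ≠ 0 → (∀ (T : Over (Spec (.of K₁))) (u : T ⟶ A₀.X), A₀.MemKOfL L₀ u → u ^ n = 1) →
      ∀ {J : Type} [Finite J] (U : J → A₀.X.left.Opens), (∀ i, IsAffineOpen (U i)) → iSup U = ⊤ →
        Module.Finite K₁ (Literature.AlgebraicGeometry.Morphisms.CechH1 A₀.X.hom U) ∧
          Module.finrank K₁ (Literature.AlgebraicGeometry.Morphisms.CechH1 A₀.X.hom U) = A₀.toAffine.toAbelianVariety.dim) :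
    ∀ (R : Type) [CommRing R] [IsNoetherianRing R] (A : AbelianSchemeOver (Spec (.of R)))
    (_hA : IsProjective A.X.hom) (L : A.left.Modules) (hL : HasRank L 1),
    CechPic.pullback A.unitSection (detClass (HasRank.isFiniteLocallyFree' hL)) = 1 →
    (∀ ⦃Ω : Type⦄ [Field Ω] [IsAlgClosed Ω] (s : Spec (.of Ω) ⟶ Spec (.of R)),
      ∃ Θ : CartierDivisor (A.fibre s).toAbelianVariety.X.left, Θ.IsAmple ∧
        CechPic.pullback (X := (A.fibre s).toAbelianVariety.X.left) (pullback.fst A.X.hom s)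
          (detClass (HasRank.isFiniteLocallyFree' hL)) = Θ.cechClass) →
    ∀ (n : ℕ), IsUnit ((n : ℕ) : R) →
      (∀ (T : Over (Spec (.of R))) (u : T ⟶ A.X), A.MemKOfL L u → u ^ n = 1) →
      Nonempty A.DualPair := by
  intro R _ _ A hA L hL hε hΘ n hn hkill
  classical
  rcases subsingleton_or_nontrivial R with hR | hR
  · -- the zero ring: `Spec R = ∅`, glue over the EMPTY cover
    haveI : IsEmpty ↥(Spec (.of R)) := inferInstanceAs (IsEmpty (PrimeSpectrum R))
    let 𝒰 : Scheme.OpenCover.{0} (Spec (.of R)) :=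
      Scheme.Cover.mkOfCovers (P := @IsOpenImmersion) PEmpty.{1} (fun j => j.elim) (fun j => j.elim)
        (fun x => (IsEmpty.false (α := ↥(Spec (.of R))) x).elim) (fun j => j.elim)
    exact nonempty_dualPair_of_openCover' A 𝒰 (fun j => PEmpty.elim j)
  · -- `n ≠ 0` (a unit of a non-trivial ring is non-zero)
    haveI : NeZero n := ⟨by
      rintro rfl
      rw [Nat.cast_zero] at hn
      exact not_isUnit_zero hn⟩
    -- (K′) on `Spec R`: `K(L)` represented by a finite étale `i` with `i ^ n = 1`
    obtain ⟨Z, i, hci, hZfin, hZet, hin, hZ⟩ := A.exists_kOfL_etale_of_isUnit hL hε hn hkill hΘ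
    -- connected affine charts of the Noetherian `Spec R`
    choose Rs instRs ch hch using fun s : ↥(Spec (.of R)) => exists_connected_affine_nbhd (S := Spec (.of R)) s
    let 𝒰 : (Spec (.of R)).OpenCover :=
      Scheme.Cover.mkOfCovers (P := @IsOpenImmersion) _ (fun s => Spec (.of (Rs s))) ch
        (fun s => ⟨s, (hch s).2.1.choose, (hch s).2.1.choose_spec⟩) (fun s => (hch s).1)
    refine nonempty_dualPair_of_openCover' A 𝒰 fun s => ?_
    haveI : IsOpenImmersion (ch s) := (hch s).1
    haveI : ConnectedSpace ↥(Spec (.of (Rs s))) := (hch s).2.2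
    haveI : IsLocallyNoetherian (Spec (.of (Rs s))) := isLocallyNoetherian_of_isOpenImmersion (ch s)
    haveI : IsNoetherianRing (Rs s) := (isLocallyNoetherian_Spec (R := .of (Rs s))).mp inferInstance
    -- the chart data: base change, rank, rigidification, fibre classes, exponent, killing, projectivity
    have hbc := A.baseChange_isBaseChangeVia (ch s)
    have hL' : HasRank ((Scheme.Modules.pullback (pullback.fst A.X.hom (ch s))).obj L) 1 :=
      hasRank_pullback (pullback.fst A.X.hom (ch s)) hL
    have hε' := A.pullback_unitSection_detClass_baseChange_eq_one (ch s) hL hε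
    have hΘ' : ∀ ⦃Ω : Type⦄ [Field Ω] [IsAlgClosed Ω] (s' : Spec (.of Ω) ⟶ Spec (.of (Rs s))),
        ∃ Θ' : CartierDivisor ((A.baseChange (ch s)).fibre s').toAbelianVariety.X.left, Θ'.IsAmple ∧
          CechPic.pullback (X := ((A.baseChange (ch s)).fibre s').toAbelianVariety.X.left) (pullback.fst (A.baseChange (ch s)).X.hom s')
            (detClass (HasRank.isFiniteLocallyFree' hL')) = Θ'.cechClass :=
      fun Ω _ _ s' => A.exists_isAmple_cechClass_fibre_baseChange hL hΘ (ch s) hL' s'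
    have hn' : IsUnit ((n : ℕ) : Rs s) := by
      have h := hn.map (Spec.preimage (ch s)).hom
      rwa [map_natCast] at h
    have hkill' : ∀ (T : Over (Spec (.of (Rs s)))) (u : T ⟶ (A.baseChange (ch s)).X),
        (A.baseChange (ch s)).MemKOfL ((Scheme.Modules.pullback (pullback.fst A.X.hom (ch s))).obj L) u → u ^ n = 1 :=
      fun T u hu => hbc.pow_eq_one_of_memKOfL_pullback hL i hZ hin u hu
    have hA' : IsProjective (A.baseChange (ch s)).X.hom := by
      rw [AbelianSchemeOver.baseChange_hom]
      exact hA.pullback_snd (ch s)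
    -- the `H¹`-count at every field point of every base change of the chart family, read off the (H-b) head `hHead`
    have hH1' : ∀ {S₁ : Scheme.{0}} (p₁ : S₁ ⟶ Spec (.of (Rs s))) (K₁ : Type) [Field K₁] (s₁ : Spec (.of K₁) ⟶ S₁) {J : Type} [Finite J]
        (U : J → (((A.baseChange (ch s)).baseChange p₁).X ⊗ Over.mk s₁).left.Opens), (∀ i, IsAffineOpen (U i)) → iSup U = ⊤ →
        Module.Finite K₁ (Literature.AlgebraicGeometry.Morphisms.CechH1 (X := (((A.baseChange (ch s)).baseChange p₁).X ⊗ Over.mk s₁).left)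
          (Limits.pullback.snd ((A.baseChange (ch s)).baseChange p₁).X.hom s₁) U) ∧
          Module.finrank K₁ (Literature.AlgebraicGeometry.Morphisms.CechH1 (X := (((A.baseChange (ch s)).baseChange p₁).X ⊗ Over.mk s₁).left)
            (Limits.pullback.snd ((A.baseChange (ch s)).baseChange p₁).X.hom s₁) U) =
            (((A.baseChange (ch s)).baseChange p₁).fibre s₁).toAbelianVariety.dim := by
      intro S₁ p₁ K₁ _ s₁ J _ U hU hUcov
      -- the fibre as a base change of `A` itself (three cartesian squares)
      have hbc₃ := (((A.baseChange (ch s)).baseChange p₁).baseChange_isBaseChangeVia s₁).trans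
        (((A.baseChange (ch s)).baseChange_isBaseChangeVia p₁).trans hbc)
      -- `n` is non-zero in `K₁`
      have hnK : ((n : ℕ) : K₁) ≠ 0 := by
        have h := hn.map (Spec.preimage (s₁ ≫ p₁ ≫ ch s)).hom
        rw [map_natCast] at h
        exact h.ne_zero
      exact hHead K₁ (((A.baseChange (ch s)).baseChange p₁).baseChange s₁) _
        (hasRank_pullback (pullback.fst ((A.baseChange (ch s)).baseChange p₁).X.hom s₁ ≫
          pullback.fst (A.baseChange (ch s)).X.hom p₁ ≫ pullback.fst A.X.hom (ch s)) hL) n hnK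
        (fun T u hu => hbc₃.pow_eq_one_of_memKOfL_pullback hL i hZ hin u hu) U hU hUcov
    -- (K′) on the chart, then (M′)
    have hK' := (A.baseChange (ch s)).exists_kOfL_etale_of_isUnit hL' hε' hn' hkill' hΘ'
    exact (nonempty_dualPair_of_isProjective_of_split (Rs s) (A.baseChange (ch s)) hA' _ hL' hε' hΘ' n hn' hK' hH1').some

/-- **The letter glued over a locally Noetherian base** — the shape the hodgecm chain meets at a stage (step (4), LEAD «M-55c» (t1)): an abelian scheme `A∕S`, `S`
locally Noetherian, with a family of affine open charts `cⱼ : Spec Rⱼ ↪ S` (`Rⱼ` Noetherian) covering `S` over each of which the base change is projective and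
carries the letter's data (`Lⱼ`, `hε`, `hΘ`, `nⱼ ∈ Rⱼ^×`, `hkill`), has a dual pair — GIVEN the (H-b) `H¹`-count head `hHead` ([MumfordAV1970] §13 Cor. 2,
the one named hole of the road-(A) chain) — the head on each chart, glued by (Z).
[cite: MumfordFogartyKirwan1994, Ch. 6 §1 Cor. 6.8 (p. 118)] [cite: BoschLutkebohmertRaynaud1990, §8.1 Prop. 4 (pp. 204–205)] [cite: MumfordAV1970, §13 Cor. 2] -/
theorem nonempty_dualPair_of_charts_of_isProjective_of_isUnit
    -- (H-b) THE `H¹`-COUNT HEAD AS A HYPOTHESIS ([MumfordAV1970] §13 Cor. 2 for an abelian scheme over a field whose `K(L)` is killed by an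
    -- integer invertible in the field; owner B-p04 (g42), LA4-plan (g0) ruling 2026-09-02T03:21:41Z (5)): the ONE named hole of the road-(A) chain.
    (hHead : ∀ (K₁ : Type) [Field K₁] (A₀ : AbelianSchemeOver (Spec (.of K₁))) (L₀ : A₀.left.Modules), HasRank L₀ 1 →
      ∀ n : ℕ, (n : K₁) ≠ 0 → (∀ (T : Over (Spec (.of K₁))) (u : T ⟶ A₀.X), A₀.MemKOfL L₀ u → u ^ n = 1) →
      ∀ {J : Type} [Finite J] (U : J → A₀.X.left.Opens), (∀ i, IsAffineOpen (U i)) → iSup U = ⊤ →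
        Module.Finite K₁ (Literature.AlgebraicGeometry.Morphisms.CechH1 A₀.X.hom U) ∧
          Module.finrank K₁ (Literature.AlgebraicGeometry.Morphisms.CechH1 A₀.X.hom U) = A₀.toAffine.toAbelianVariety.dim)
    {S : Scheme.{0}} [IsLocallyNoetherian S] (A : AbelianSchemeOver S)
    {J : Type} (R : J → Type) [∀ j, CommRing (R j)] [∀ j, IsNoetherianRing (R j)] (c : ∀ j, Spec (.of (R j)) ⟶ S)
    [∀ j, IsOpenImmersion (c j)] (hcov : ∀ s : S, ∃ j, s ∈ Set.range (c j))
    (hproj : ∀ j, IsProjective (A.baseChange (c j)).X.hom)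
    (L : ∀ j, (A.baseChange (c j)).left.Modules) (hL : ∀ j, HasRank (L j) 1)
    (hε : ∀ j, CechPic.pullback (A.baseChange (c j)).unitSection (detClass (HasRank.isFiniteLocallyFree' (hL j))) = 1)
    (hΘ : ∀ j ⦃Ω : Type⦄ [Field Ω] [IsAlgClosed Ω] (t : Spec (.of Ω) ⟶ Spec (.of (R j))),
      ∃ Θ : CartierDivisor ((A.baseChange (c j)).fibre t).toAbelianVariety.X.left, Θ.IsAmple ∧
        CechPic.pullback (X := ((A.baseChange (c j)).fibre t).toAbelianVariety.X.left) (pullback.fst (A.baseChange (c j)).X.hom t)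
          (detClass (HasRank.isFiniteLocallyFree' (hL j))) = Θ.cechClass)
    (n : J → ℕ) (hn : ∀ j, IsUnit ((n j : ℕ) : R j))
    (hkill : ∀ j (T : Over (Spec (.of (R j)))) (u : T ⟶ (A.baseChange (c j)).X), (A.baseChange (c j)).MemKOfL (L j) u → u ^ n j = 1) :
    Nonempty A.DualPair := by
  classical
  let 𝒰 : Scheme.OpenCover.{0} S :=
    Scheme.Cover.mkOfCovers (P := @IsOpenImmersion) J (fun j => Spec (.of (R j))) c
      (fun s => ⟨(hcov s).choose, (hcov s).choose_spec.choose, (hcov s).choose_spec.choose_spec⟩) inferInstance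
  refine nonempty_dualPair_of_openCover' A 𝒰 fun j => ?_
  exact (nonempty_dualPair_of_isProjective_of_isUnit hHead (R j) (A.baseChange (c j)) (hproj j) (L j) (hL j) (hε j) (hΘ j) (n j)
    (hn j) (hkill j)).some

/-! ## Edition 2 — THE LETTER WITHOUT THE HOLE: `hH1` discharged by ★ `CechH1CountOfPoincareDataHead.hH1_of_letter`
(B-p04 (g42) HEAD ★ `finite_finrank_cechH1_eq_of_poincareData`, [MumfordAV1970] §13 Cor. 2 in any characteristic) -/

/-- **THE DUALS LETTER `DualPairOfAmpleRigidified`, HYPOTHESIS-FREE** — the dual abelian scheme EXISTS for a PROJECTIVE abelian scheme over a Noetherian ring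
carrying a rank-one `L` rigidified along the unit section, fibrewise of the class of an ample divisor, whose `K(L)` is killed by an exponent `n` INVERTIBLE in
the ring, in ANY characteristic ([MumfordAV1970] §13 Theorem: `Â = A⁄K(L)` with the descended Poincaré bundle, universal; §23 ∕ [MumfordFogartyKirwan1994]
Prop. 6.13 (iii)).  The statement IS the hodgecm letter (P-line `Cruxes/HLiu418/Lines/F0_P6a_PELInputs.lean` :521) TOKEN FOR TOKEN, so the Lines-side closer
is `theorem stub_DUALS : DualPairOfAmpleRigidified := MumfordDual.dualPairOfAmpleRigidified`.  Proof = Edition 1's, the (H-b) hole `hHead` replaced on each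
connected affine chart by ★ `MumfordDual.hH1_of_letter` (the chart family's `H¹`-count from the letter's own data: (DESC) to `K̄` + Mumford's construction over
`K̄` + [MumfordAV1970] §13 Cor. 2 from the Poincaré family).
[cite: MumfordAV1970, §13 Theorem (p. 125), §13 Cor. 2 (p. 129) and §23] [cite: MumfordFogartyKirwan1994, Ch. 6 §1 Cor. 6.8 (p. 118) and §2 Prop. 6.13 (iii) (p. 123)]
[cite: BoschLutkebohmertRaynaud1990, §8.1 Prop. 4 (pp. 204–205)] -/
theorem dualPairOfAmpleRigidified : ∀ (R : Type) [CommRing R] [IsNoetherianRing R] (A : AbelianSchemeOver (Spec (.of R)))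
    (_hA : IsProjective A.X.hom) (L : A.left.Modules) (hL : HasRank L 1),
    CechPic.pullback A.unitSection (detClass (HasRank.isFiniteLocallyFree' hL)) = 1 →
    (∀ ⦃Ω : Type⦄ [Field Ω] [IsAlgClosed Ω] (s : Spec (.of Ω) ⟶ Spec (.of R)),
      ∃ Θ : CartierDivisor (A.fibre s).toAbelianVariety.X.left, Θ.IsAmple ∧
        CechPic.pullback (X := (A.fibre s).toAbelianVariety.X.left) (pullback.fst A.X.hom s)
          (detClass (HasRank.isFiniteLocallyFree' hL)) = Θ.cechClass) →
    ∀ (n : ℕ), IsUnit ((n : ℕ) : R) →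
      (∀ (T : Over (Spec (.of R))) (u : T ⟶ A.X), A.MemKOfL L u → u ^ n = 1) →
      Nonempty A.DualPair := by
  intro R _ _ A hA L hL hε hΘ n hn hkill
  classical
  rcases subsingleton_or_nontrivial R with hR | hR
  · -- the zero ring: `Spec R = ∅`, glue over the EMPTY cover
    haveI : IsEmpty ↥(Spec (.of R)) := inferInstanceAs (IsEmpty (PrimeSpectrum R))
    let 𝒰 : Scheme.OpenCover.{0} (Spec (.of R)) :=
      Scheme.Cover.mkOfCovers (P := @IsOpenImmersion) PEmpty.{1} (fun j => j.elim) (fun j => j.elim)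
        (fun x => (IsEmpty.false (α := ↥(Spec (.of R))) x).elim) (fun j => j.elim)
    exact nonempty_dualPair_of_openCover' A 𝒰 (fun j => PEmpty.elim j)
  · -- `n ≠ 0` (a unit of a non-trivial ring is non-zero)
    haveI : NeZero n := ⟨by
      rintro rfl
      rw [Nat.cast_zero] at hn
      exact not_isUnit_zero hn⟩
    -- (K′) on `Spec R`: `K(L)` represented by a finite étale `i` with `i ^ n = 1`
    obtain ⟨Z, i, hci, hZfin, hZet, hin, hZ⟩ := A.exists_kOfL_etale_of_isUnit hL hε hn hkill hΘ
    -- connected affine charts of the Noetherian `Spec R`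
    choose Rs instRs ch hch using fun s : ↥(Spec (.of R)) => exists_connected_affine_nbhd (S := Spec (.of R)) s
    let 𝒰 : (Spec (.of R)).OpenCover :=
      Scheme.Cover.mkOfCovers (P := @IsOpenImmersion) _ (fun s => Spec (.of (Rs s))) ch
        (fun s => ⟨s, (hch s).2.1.choose, (hch s).2.1.choose_spec⟩) (fun s => (hch s).1)
    refine nonempty_dualPair_of_openCover' A 𝒰 fun s => ?_
    haveI : IsOpenImmersion (ch s) := (hch s).1
    haveI : ConnectedSpace ↥(Spec (.of (Rs s))) := (hch s).2.2
    haveI : IsLocallyNoetherian (Spec (.of (Rs s))) := isLocallyNoetherian_of_isOpenImmersion (ch s)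
    haveI : IsNoetherianRing (Rs s) := (isLocallyNoetherian_Spec (R := .of (Rs s))).mp inferInstance
    -- the chart data: base change, rank, rigidification, fibre classes, exponent, killing, projectivity
    have hbc := A.baseChange_isBaseChangeVia (ch s)
    have hL' : HasRank ((Scheme.Modules.pullback (pullback.fst A.X.hom (ch s))).obj L) 1 :=
      hasRank_pullback (pullback.fst A.X.hom (ch s)) hL
    have hε' := A.pullback_unitSection_detClass_baseChange_eq_one (ch s) hL hε
    have hΘ' : ∀ ⦃Ω : Type⦄ [Field Ω] [IsAlgClosed Ω] (s' : Spec (.of Ω) ⟶ Spec (.of (Rs s))),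
        ∃ Θ' : CartierDivisor ((A.baseChange (ch s)).fibre s').toAbelianVariety.X.left, Θ'.IsAmple ∧
          CechPic.pullback (X := ((A.baseChange (ch s)).fibre s').toAbelianVariety.X.left) (pullback.fst (A.baseChange (ch s)).X.hom s')
            (detClass (HasRank.isFiniteLocallyFree' hL')) = Θ'.cechClass :=
      fun Ω _ _ s' => A.exists_isAmple_cechClass_fibre_baseChange hL hΘ (ch s) hL' s'
    have hn' : IsUnit ((n : ℕ) : Rs s) := by
      have h := hn.map (Spec.preimage (ch s)).hom
      rwa [map_natCast] at h
    have hkill' : ∀ (T : Over (Spec (.of (Rs s)))) (u : T ⟶ (A.baseChange (ch s)).X),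
        (A.baseChange (ch s)).MemKOfL ((Scheme.Modules.pullback (pullback.fst A.X.hom (ch s))).obj L) u → u ^ n = 1 :=
      fun T u hu => hbc.pow_eq_one_of_memKOfL_pullback hL i hZ hin u hu
    have hA' : IsProjective (A.baseChange (ch s)).X.hom := by
      rw [AbelianSchemeOver.baseChange_hom]
      exact hA.pullback_snd (ch s)
    -- (K′) on the chart, then (M′) with the chart family's `H¹`-count ★ `hH1_of_letter` from the chart's own letter data
    have hK' := (A.baseChange (ch s)).exists_kOfL_etale_of_isUnit hL' hε' hn' hkill' hΘ'
    exact (nonempty_dualPair_of_isProjective_of_split (Rs s) (A.baseChange (ch s)) hA' _ hL' hε' hΘ' n hn' hK'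
      (hH1_of_letter (Rs s) (A.baseChange (ch s)) hA' _ hL' hε' hΘ' n hn' hkill')).some

/-- **The letter glued over a locally Noetherian base, HYPOTHESIS-FREE** (Edition 1's `nonempty_dualPair_of_charts_of_isProjective_of_isUnit` without the
hole): an abelian scheme `A∕S`, `S` locally Noetherian, with a family of affine open charts `cⱼ : Spec Rⱼ ↪ S` (`Rⱼ` Noetherian) covering `S` over each of
which the base change is projective and carries the letter's data (`Lⱼ`, `hε`, `hΘ`, `nⱼ ∈ Rⱼ^×`, `hkill`), has a dual pair — `dualPairOfAmpleRigidified` on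
each chart, glued by (Z). [cite: MumfordFogartyKirwan1994, Ch. 6 §1 Cor. 6.8 (p. 118)] [cite: BoschLutkebohmertRaynaud1990, §8.1 Prop. 4 (pp. 204–205)]
[cite: MumfordAV1970, §13 Theorem (p. 125) and Cor. 2 (p. 129)] -/
theorem nonempty_dualPair_of_charts_of_isProjective_of_isUnit' {S : Scheme.{0}} [IsLocallyNoetherian S] (A : AbelianSchemeOver S)
    {J : Type} (R : J → Type) [∀ j, CommRing (R j)] [∀ j, IsNoetherianRing (R j)] (c : ∀ j, Spec (.of (R j)) ⟶ S)
    [∀ j, IsOpenImmersion (c j)] (hcov : ∀ s : S, ∃ j, s ∈ Set.range (c j))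
    (hproj : ∀ j, IsProjective (A.baseChange (c j)).X.hom)
    (L : ∀ j, (A.baseChange (c j)).left.Modules) (hL : ∀ j, HasRank (L j) 1)
    (hε : ∀ j, CechPic.pullback (A.baseChange (c j)).unitSection (detClass (HasRank.isFiniteLocallyFree' (hL j))) = 1)
    (hΘ : ∀ j ⦃Ω : Type⦄ [Field Ω] [IsAlgClosed Ω] (t : Spec (.of Ω) ⟶ Spec (.of (R j))),
      ∃ Θ : CartierDivisor ((A.baseChange (c j)).fibre t).toAbelianVariety.X.left, Θ.IsAmple ∧
        CechPic.pullback (X := ((A.baseChange (c j)).fibre t).toAbelianVariety.X.left) (pullback.fst (A.baseChange (c j)).X.hom t)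
          (detClass (HasRank.isFiniteLocallyFree' (hL j))) = Θ.cechClass)
    (n : J → ℕ) (hn : ∀ j, IsUnit ((n j : ℕ) : R j))
    (hkill : ∀ j (T : Over (Spec (.of (R j)))) (u : T ⟶ (A.baseChange (c j)).X), (A.baseChange (c j)).MemKOfL (L j) u → u ^ n j = 1) :
    Nonempty A.DualPair := by
  classical
  let 𝒰 : Scheme.OpenCover.{0} S :=
    Scheme.Cover.mkOfCovers (P := @IsOpenImmersion) J (fun j => Spec (.of (R j))) c
      (fun s => ⟨(hcov s).choose, (hcov s).choose_spec.choose, (hcov s).choose_spec.choose_spec⟩) inferInstance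
  refine nonempty_dualPair_of_openCover' A 𝒰 fun j => ?_
  exact (dualPairOfAmpleRigidified (R j) (A.baseChange (c j)) (hproj j) (L j) (hL j) (hε j) (hΘ j) (n j) (hn j) (hkill j)).some

end MumfordDual

end Literature.AlgebraicGeometry.AbelianSchemes

end
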